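import Literature.MathematicalPhysics.QuantumFieldTheory.Balaban1983to89.B1Ineq36HiggsModel
import Literature.MathematicalPhysics.QuantumFieldTheory.Balaban1983to89.B1Eq31Concrete

/-!
# `Balaban1983to89.B1Ineq36Printed` — T. Bałaban, *(Higgs)₂,₃ quantum fields in a finite volume. I. A lower bound*,
Commun. Math. Phys. **85** (1982) 603–626 [Balaban1982Higgs1], (3.6) p. 613 WITH THE PRINTED CHARACTERISTIC FUNCTIONS
(3.1)–(3.5): the first lower-bound step `Z^ε ≥ ∫dB∫dψ χ₁(B)χ₁(ψ) T^ε_{a,L}[T^ε_{a,L,A}[χ₀(A)χ₀(φ)exp(−S^ε)]]` for the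
(Higgs)₂,₃ model, every symbol concrete — the typer's model instance `B1Ineq36HiggsModel.lowerStep36` (general
measurable `[0,1]`-valued weights) specialised to the concrete `χ₀(A)`, `χ₀(φ)`, `χ₁(B)`, `χ₁(ψ)` of `B1Eq31Concrete`

statement-level skeleton of published theorems with citation tags; proofs where landed; nothing here is a claim about the Yang–Mills mass gap

PDF held: `paper:balaban1982-cmp85-higgs23-i` (journal page = PDF page + 602).  Display (3.6) read from the ×2 render
`run/shared/lean/pub/pub-balaban/b2b-balaban-ref1/pages/1982-cmp85-higgs23-I/1982-cmp85-higgs23-I-p011-x2.png` (p. 613).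

CITATION HEADER (lean-in-tree rule).  lit-balaban typed skeleton (HOME `run/shared/lean/pub/lit-balaban/`), SKELETON row
**B1.Eq3.6** (owner r14; theorem of record = r14's MECHANISM `B1Ineq36LowerStep.integral_cutoff_double_cutoff_le`,
p244195; model instance with general weights = typer's `B1Ineq36HiggsModel.lowerStep36`).  WHAT IS REPRODUCED: p. 613,
verbatim: *"and the following inequality holds Z^ε ≥ ∫dB∫dψ χ₁(B)χ₁(ψ) T^ε_{a,L}[T^ε_{a,L,A}[χ₀(A)χ₀(φ)exp(−S^ε)]]. (3.6)"*
with `Z^ε` = `HiggsLattice.partitionFn` (1.10), the double transformation `B2Eq21FirstStep.doubleRT` ((2.4)–(2.7) at the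
external field `A`, then the vector-field transformation, p. 608), `S^ε` = `HiggsLattice.action` (1.11), and NOW the
characteristic functions THEMSELVES: `χ₀(A)` = `B1Eq31Concrete.chi0A` (3.1) and `χ₀(φ)` = `chi0φ` (3.2) at `ℓ = ε`,
`p(ε) = b₀(1 + log ε⁻¹)^p`; `χ₁(B)` = `chi1B` (3.4) and `χ₁(ψ)` = `chi1ψ` (3.5) at `ℓ = Lε`, `p(Lε)`, built on the
background fields `B^{(1),ε}`, `ψ^{(1),ε}` (3.3) (vector-field mass `μ₀²` of (1.11), scalar mass `m²` — the parameter
`msq`, the renormalized mass; `Couplings.m0sq = m² + δm²`).  PROVED (`lowerStep36_printed`): `lowerStep36` with its three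
weight hypotheses discharged by `B1Eq31Concrete.measurable_chi0` (joint measurability of `(A, φ) ↦ χ₀(A)χ₀(φ)` — `χ₀(φ)`
depends on `A` through `Δ^ε_A`), `chi0_mem_Icc`, `chi1_mem_Icc`; hypotheses as in `lowerStep36`: `a > 0` and the
standing assumptions *"μ₀² > 0 and λ > 0"* (p. 605); `b₀, p, m²` arbitrary reals.  Also the general step's outer/inner
weights `χ_k(A)χ_k(φ)` (3.27)–(3.28) in the same inequality shape ((3.6) with `χ_k`-type outer
weights at any scale parameters, `lowerStep36_scales` — the form in which (3.26) p. 617 feeds the next step).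
Also the base case `k = 0` of the induction hypothesis (3.26) p. 617 for the model with the printed `χ₀`:
`∫dA∫dφ χ₀(A)χ₀(φ)exp(−S^ε) ≤ Z^ε` (`base326_printed`; the schematic base is p14's `B1IndHyp326Proof.base326`).
DELIBERATELY NOT HERE: anything after (3.6).
Unit `lit-balaban-typer` gen 3 (literature-prover-lit-balaban-typer-g3-0); HOME/FILED.md records the proposal.
-/

open scoped BigOperators
open _root_.MeasureTheory

namespace Literature.MathematicalPhysics.QuantumFieldTheory.Balaban1983to89.B1Ineq36Printed

open Literature.MathematicalPhysics.QuantumFieldTheory.Balaban1983to89.HiggsLattice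
open Literature.MathematicalPhysics.QuantumFieldTheory.Balaban1983to89.B2Eq21FirstStep (doubleRT)
open Literature.MathematicalPhysics.QuantumFieldTheory.Balaban1983to89.B1Ineq36HiggsModel (lowerStep36)
open Literature.MathematicalPhysics.QuantumFieldTheory.Balaban1983to89.B1Eq31Concrete
open Literature.MathematicalPhysics.QuantumFieldTheory.Balaban1983to89.HiggsActionIntegrable
  (integrable_exp_neg_action partitionFn_eq)

variable {P : Params} {N : ℕ}

/-- **(3.6) p. 613 LITERALLY AS PRINTED, for the (Higgs)₂,₃ model**: for `a > 0`, couplings with `μ₀² > 0`, `λ > 0`,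
and any `b₀, p` (the constants of `p(ε) = b₀(1 + log ε⁻¹)^p`) and scalar mass `m²`,
`∫dB∫dψ χ₁(B)χ₁(ψ) T^ε_{a,L}[T^ε_{a,L,A}[χ₀(A)χ₀(φ)exp(−S^ε)]] ≤ Z^ε`
with `χ₀(A)`, `χ₀(φ)` the products (3.1)–(3.2) at `ℓ = ε`, `p(ε)` and `χ₁(B)`, `χ₁(ψ)` the products (3.4)–(3.5) at
`ℓ = Lε`, `p(Lε)` on the background fields (3.3). PROVED. [cite: Balaban1982Higgs1, (3.6) p.613] -/
theorem lowerStep36_printed {a : ℝ} (ha : 0 < a) (C : ChargeData N) (c : Couplings) (hmu : 0 < c.mu0sq)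
    (hlam : 0 < c.lam) (b₀ p msq : ℝ) :
    ∫ Ψ : VecField P 1 × ScalarField P 1 N,
        chi1B (P.mesh 1) (B2.pFn b₀ p (P.mesh 1)) c.mu0sq a Ψ.1
          * chi1ψ C (P.mesh 1) (B2.pFn b₀ p (P.mesh 1)) c.mu0sq msq a Ψ.1 Ψ.2
          * doubleRT C a (fun A φ => chi0A (P.mesh 0) (B2.pFn b₀ p (P.mesh 0)) A
              * chi0φ C (P.mesh 0) (B2.pFn b₀ p (P.mesh 0)) A φ * Real.exp (-action C c A φ)) Ψ.1 Ψ.2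
      ≤ partitionFn P 0 N C c :=
  lowerStep36 ha C c hmu hlam
    (χ₀ := fun A φ => chi0A (P.mesh 0) (B2.pFn b₀ p (P.mesh 0)) A * chi0φ C (P.mesh 0) (B2.pFn b₀ p (P.mesh 0)) A φ)
    (χ₁ := fun B ψ => chi1B (P.mesh 1) (B2.pFn b₀ p (P.mesh 1)) c.mu0sq a B
      * chi1ψ C (P.mesh 1) (B2.pFn b₀ p (P.mesh 1)) c.mu0sq msq a B ψ)
    (measurable_chi0 C (P.mesh 0) (B2.pFn b₀ p (P.mesh 0)))
    (fun A φ => chi0_mem_Icc C _ _ A φ) (fun B ψ => chi1_mem_Icc C _ _ _ _ _ B ψ)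

/-- (3.6) with general scale parameters: the same inequality for the inner weight `χ₀(A)χ₀(φ)` at any `(ℓ₀, p₀)` and the
outer weight `χ_k(B)χ_k(ψ)` (3.27)–(3.28) at any level-`1` data `(ℓ₁, p₁)` — e.g. the thresholds `p(ε)` on the unit
lattice after the rescaling (3.8)–(3.9). PROVED. [cite: Balaban1982Higgs1, (3.6) p.613] -/
theorem lowerStep36_scales {a : ℝ} (ha : 0 < a) (C : ChargeData N) (c : Couplings) (hmu : 0 < c.mu0sq)
    (hlam : 0 < c.lam) (ℓ₀ p₀ ℓ₁ p₁ msq : ℝ) :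
    ∫ Ψ : VecField P 1 × ScalarField P 1 N,
        chi1B ℓ₁ p₁ c.mu0sq a Ψ.1 * chi1ψ C ℓ₁ p₁ c.mu0sq msq a Ψ.1 Ψ.2
          * doubleRT C a (fun A φ => chi0A ℓ₀ p₀ A * chi0φ C ℓ₀ p₀ A φ * Real.exp (-action C c A φ)) Ψ.1 Ψ.2
      ≤ partitionFn P 0 N C c :=
  lowerStep36 ha C c hmu hlam (χ₀ := fun A φ => chi0A ℓ₀ p₀ A * chi0φ C ℓ₀ p₀ A φ)
    (χ₁ := fun B ψ => chi1B ℓ₁ p₁ c.mu0sq a B * chi1ψ C ℓ₁ p₁ c.mu0sq msq a B ψ)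
    (measurable_chi0 C ℓ₀ p₀) (fun A φ => chi0_mem_Icc C _ _ A φ) (fun B ψ => chi1_mem_Icc C _ _ _ _ _ B ψ)

/-- **The base case `k = 0` of (3.26) p. 617 for the model, printed `χ₀`**: `∫dA∫dφ χ₀(A)χ₀(φ)exp(−S^ε(A, φ)) ≤ Z^ε`
at any thresholds `(ℓ₀, p₀)` — inserting `0 ≤ χ₀(A)χ₀(φ) ≤ 1` into (1.10) (`μ₀² > 0`, `λ > 0` for the integrability of
`exp(−S^ε)`). PROVED. [cite: Balaban1982Higgs1, (3.26) p.617] -/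
theorem base326_printed (C : ChargeData N) (c : Couplings) (hmu : 0 < c.mu0sq) (hlam : 0 < c.lam) (ℓ₀ p₀ : ℝ) :
    ∫ Φ : VecField P 0 × ScalarField P 0 N,
        chi0A ℓ₀ p₀ Φ.1 * chi0φ C ℓ₀ p₀ Φ.1 Φ.2 * Real.exp (-action C c Φ.1 Φ.2)
      ≤ partitionFn P 0 N C c := by
  rw [partitionFn_eq]
  have hS := integrable_exp_neg_action (P := P) (k := 0) (N := N) C c hmu hlam
  refine integral_mono_of_nonneg (Filter.Eventually.of_forall fun Φ => ?_) hS
    (Filter.Eventually.of_forall fun Φ => ?_)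
  · exact mul_nonneg (chi0_mem_Icc C ℓ₀ p₀ Φ.1 Φ.2).1 (Real.exp_pos _).le
  · exact mul_le_of_le_one_left (Real.exp_pos _).le (chi0_mem_Icc C ℓ₀ p₀ Φ.1 Φ.2).2

end Literature.MathematicalPhysics.QuantumFieldTheory.Balaban1983to89.B1Ineq36Printed
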